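import Literature.ModelTheory.ExponentialFields.PilaWilkieFamilyParametrization
import HarnessLib

/-!
# The Main Lemma for definable families (Pila–Wilkie 2006, Main Lemma 6.2; Bhardwaj–van den Dries 2022, Cor. 7.3)

Topic `Literature/ModelTheory/ExponentialFields`; proof file in the cone of the named fact
`PilaWilkie2006_thm_1_8`.  Pila–Wilkie's Main Lemma 6.2 (for a definable family
`Z ⊆ (0,1)^n × M^m` with fibres of dimension `k < n`: *"there exist `d(ε,k,n) ∈ ℕ` and
`K(Z,ε) > 0` such that for any `Y ∈ M^m` and `T ≥ 1`, `X(ℚ,T)` is contained in the union of at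
most `K T^ε` hypersurfaces of degree `d`"*) — in the wording of Bhardwaj–van den Dries 2022,
Cor. 7.3 — is derived here for fibres in the open unit cube from the uniform strong
parametrization of definable families (`familyParam`) and the Bombieri–Pila chart count
(`PilaWilkie2006_prop_6_1`), **modulo the uniform `r`-reparametrization property**
`UR(r, ℓ)` for all `r` and `ℓ < n`, stated inline as a hypothesis (`mainLemma_family`).

Nothing here is a named fact; no definitions.

## References

* J. Pila, A. J. Wilkie, *The rational points of a definable set*, Duke Math. J. 133 (2006),
  Main Lemma 6.2. [PilaWilkie2006]
* N. Bhardwaj, L. van den Dries, *On the Pila–Wilkie theorem*, Expo. Math. 40 (2022),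
  Cor. 7.3. [BhardwajVanDenDries2022]
-/

noncomputable section

open Set FirstOrder FirstOrder.Language Filter Topology

namespace Literature.ModelTheory.ExponentialFields

/-! ### The Main Lemma for definable families (Pila–Wilkie 2006, 6.2; Bhardwaj–van den Dries 2022, Cor. 7.3) -/

section MainLemma

open Classical

variable {L : Language} [L.Structure ℝ]

/-- Local notation: the open unit cube `(0,1)^ℓ`. -/
local notation "𝕀^" ℓ:max => (Set.pi Set.univ fun _ : Fin ℓ => Set.Ioo (0 : ℝ) 1)

/-- **The Main Lemma for definable families** (Pila–Wilkie 2006, Main Lemma 6.2; in the form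
of Bhardwaj–van den Dries 2022, Cor. 7.3: *"Suppose `E ⊆ ℝ^m` and `Z ⊆ E × [-1,1]^n` are
definable. Then there is for every `ε > 0` an `e = e(ε,n)` and a `K` with the following
property: for all `s ∈ E` with `dim Z(s) < n` and all `T`, at most `K T^ε` many hypersurfaces
in `ℝ^n` of degree `≤ e` are enough to cover the set `Z(s)(ℚ,T)`"*), here for fibres in the
open unit cube and **modulo the uniform `r`-reparametrization property** `UR(r, ℓ)` for all
`r` and all `ℓ < n` (stated inline): from `familyParam` (the uniform strong parametrization)
and `PilaWilkie2006_prop_6_1` (Bombieri–Pila) applied chart by chart.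
[cite: PilaWilkie2006, Main Lemma 6.2] [cite: BhardwajVanDenDries2022, Cor. 7.3] -/
theorem mainLemma_family {p n : ℕ} (hO : L.IsOMinimal ℝ)
    (hadd : (univ : Set ℝ).Definable L {v : Fin 3 → ℝ | v 0 + v 1 = v 2})
    (hmul : (univ : Set ℝ).Definable L {v : Fin 3 → ℝ | v 0 * v 1 = v 2})
    (hUR : ∀ (r ℓ : ℕ), ℓ < n → ∀ (n' m : ℕ) (F : Fin n' → (Fin m → ℝ) → (Fin ℓ → ℝ) → ℝ),
      (∀ l, IsDefinableFamily L (F l)) → (∀ l v, ∀ x ∈ 𝕀^ℓ, |F l v x| ≤ 1) →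
      ∃ (κ : Type) (_ : Fintype κ) (ψ : κ → (Fin m → ℝ) → (Fin ℓ → ℝ) → (Fin ℓ → ℝ)),
        (∀ j c, IsDefinableFamily L (fun v x => ψ j v x c)) ∧
        ∀ v, (∀ j, MapsTo (ψ j v) (𝕀^ℓ) (𝕀^ℓ)) ∧ (⋃ j, ψ j v '' 𝕀^ℓ) = 𝕀^ℓ ∧
          (∀ j c, ContDiffOn ℝ r (fun x => ψ j v x c) (𝕀^ℓ)) ∧
          (∀ j c, ∀ q ≤ r, ∀ x ∈ 𝕀^ℓ, ‖iteratedFDeriv ℝ q (fun x => ψ j v x c) x‖ ≤ 1) ∧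
          (∀ j l, ContDiffOn ℝ r (fun x => F l v (ψ j v x)) (𝕀^ℓ)) ∧
          (∀ j l, ∀ q ≤ r, ∀ x ∈ 𝕀^ℓ, ‖iteratedFDeriv ℝ q (fun x => F l v (ψ j v x)) x‖ ≤ 1))
    (Z : Set (Fin (p + n) → ℝ)) (hZ : (univ : Set ℝ).Definable L Z)
    (hZsub : ∀ v : Fin p → ℝ, {z : Fin n → ℝ | (Fin.append v z :) ∈ Z} ⊆ 𝕀^n)
    {ε : ℝ} (hε : 0 < ε) :
    ∃ (d : ℕ) (K : ℝ), 1 ≤ d ∧ 0 < K ∧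
      ∀ v : Fin p → ℝ, CellDimension.dim L n {z : Fin n → ℝ | (Fin.append v z :) ∈ Z} < n →
        ∀ H : ℕ, 1 ≤ H →
          ∃ Ps : Finset (MvPolynomial (Fin n) ℝ), (Ps.card : ℝ) ≤ K * (H : ℝ) ^ ε ∧
            (∀ P ∈ Ps, P ≠ 0 ∧ P.totalDegree ≤ d) ∧
            ratPointsLE {z : Fin n → ℝ | (Fin.append v z :) ∈ Z} H ⊆
              ⋃ P ∈ Ps, {x | MvPolynomial.eval x P = 0} := by
  -- Bombieri–Pila data for each chart dimension `k < n`
  have h61 : ∀ k : Fin n, ∃ (b d : ℕ) (C : ℝ), 1 ≤ d ∧ 0 < C ∧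
      ∀ (φ : (Fin k → ℝ) → Fin n → ℝ),
        (∀ l, ContDiffOn ℝ (b + 1) (fun x => φ x l) (𝕀^k)) →
        (∀ l, ∀ i ≤ b + 1, ∀ x ∈ 𝕀^k, ‖iteratedFDeriv ℝ i (fun x => φ x l) x‖ ≤ 1) →
        ∀ H : ℕ, 1 ≤ H →
          ∃ Ps : Finset (MvPolynomial (Fin n) ℝ), (Ps.card : ℝ) ≤ C * (H : ℝ) ^ ε ∧
            (∀ P ∈ Ps, P ≠ 0 ∧ P.totalDegree ≤ d) ∧
            ratPointsLE (φ '' 𝕀^k) H ⊆ ⋃ P ∈ Ps, {x | MvPolynomial.eval x P = 0} :=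
    fun k => PilaWilkie2006_prop_6_1 k.isLt hε
  choose b d C hd hC h61' using h61
  -- a common smoothness order
  set r : ℕ := Finset.univ.sup b + 1 with hr
  have hbr : ∀ k, b k + 1 ≤ r := fun k => by
    have := Finset.le_sup (f := b) (Finset.mem_univ k); omega
  obtain ⟨κ, hκ, ℓ, A, φ, hℓ, -, -, hφ⟩ :=
    familyParam (r := r) hO hadd hmul (fun ℓ hℓ => hUR r ℓ hℓ) Z hZ hZsub
  -- constants
  set C' : κ → ℝ := fun j => if h : ℓ j < n then C ⟨ℓ j, h⟩ else 0 with hC'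
  have hC'0 : ∀ j, 0 ≤ C' j := fun j => by
    simp only [hC']; split_ifs with h
    · exact (hC _).le
    · exact le_rfl
  set K : ℝ := Finset.univ.sum C' + 1 with hK
  set dd : ℕ := Finset.univ.sup d + 1 with hdd
  have hK0 : 0 < K := by
    have : 0 ≤ Finset.univ.sum C' := Finset.sum_nonneg fun j _ => hC'0 j
    rw [hK]; linarith
  refine ⟨dd, K, by omega, hK0, fun v hdim H hH => ?_⟩
  obtain ⟨hcov, hact⟩ := hφ v
  -- polynomials chart by chart
  have hchart : ∀ j, A j v → ∃ Ps : Finset (MvPolynomial (Fin n) ℝ), (Ps.card : ℝ) ≤ C' j * (H : ℝ) ^ ε ∧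
      (∀ P ∈ Ps, P ≠ 0 ∧ P.totalDegree ≤ dd) ∧
      ratPointsLE (φ j v '' 𝕀^(ℓ j)) H ⊆ ⋃ P ∈ Ps, {x | MvPolynomial.eval x P = 0} := by
    intro j hj
    obtain ⟨-, hCr, hbd, hℓdim⟩ := hact j hj
    have hℓn : ℓ j < n := lt_of_le_of_lt hℓdim hdim
    set k : Fin n := ⟨ℓ j, hℓn⟩ with hk
    have hC'j : C' j = C k := by simp only [hC', hk, dif_pos hℓn]
    obtain ⟨Ps, hcard, hdeg, hsub⟩ := h61' k (fun x c => φ j v x c)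
      (fun c => (hCr c).of_le (by exact_mod_cast hbr k))
      (fun c i hi x hx => hbd c i (hi.trans (hbr k)) x hx) H hH
    refine ⟨Ps, by rw [hC'j]; exact hcard, fun P hP => ⟨(hdeg P hP).1, (hdeg P hP).2.trans ?_⟩, hsub⟩
    have := Finset.le_sup (f := d) (Finset.mem_univ k); omega
  choose! Ps hPscard hPsdeg hPssub using hchart
  refine ⟨(Finset.univ.filter fun j => A j v).biUnion Ps, ?_, ?_, ?_⟩
  · -- cardinality
    calc (((Finset.univ.filter fun j => A j v).biUnion Ps).card : ℝ)
        ≤ ∑ j ∈ Finset.univ.filter (fun j => A j v), ((Ps j).card : ℝ) := by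
          exact_mod_cast Finset.card_biUnion_le
      _ ≤ ∑ j ∈ Finset.univ.filter (fun j => A j v), C' j * (H : ℝ) ^ ε :=
          Finset.sum_le_sum fun j hj => hPscard j (Finset.mem_filter.mp hj).2
      _ ≤ ∑ j ∈ Finset.univ, C' j * (H : ℝ) ^ ε :=
          Finset.sum_le_sum_of_subset_of_nonneg (Finset.filter_subset _ _)
            fun j _ _ => mul_nonneg (hC'0 j) (by positivity)
      _ = (Finset.univ.sum C') * (H : ℝ) ^ ε := by rw [Finset.sum_mul]
      _ ≤ K * (H : ℝ) ^ ε := by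
          apply mul_le_mul_of_nonneg_right _ (by positivity)
          rw [hK]; linarith
  · intro P hP
    obtain ⟨j, hj, hPj⟩ := Finset.mem_biUnion.mp hP
    exact hPsdeg j (Finset.mem_filter.mp hj).2 P hPj
  · intro z hz
    obtain ⟨hzZ, hzrat⟩ := hz
    rw [hcov] at hzZ
    obtain ⟨j, hjz⟩ := mem_iUnion.mp hzZ
    obtain ⟨hj, hjz'⟩ := mem_iUnion.mp hjz
    have hmem : z ∈ ratPointsLE (φ j v '' 𝕀^(ℓ j)) H := ⟨hjz', hzrat⟩
    have h := hPssub j hj hmem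
    simp only [mem_iUnion] at h ⊢
    obtain ⟨P, hP, hPz⟩ := h
    exact ⟨P, Finset.mem_biUnion.mpr ⟨j, Finset.mem_filter.mpr ⟨Finset.mem_univ _, hj⟩, hP⟩, hPz⟩

end MainLemma


end Literature.ModelTheory.ExponentialFields

end
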